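import Summits.QuantumFields.BalabanUV.Beta.GAN24.SrecBornSector

/-!
# `BalabanUV.Beta.GAN24.WardResidualSUnits` — binder row G-an2-4 / (CONV-C), CT-W route of record «WC-TL», (Q-R) by «QR-LL», row (REP) IN UNITS:
# **THE (REP) TRANSPORTS ARE leaf-01's `stepMap ∕ unitStepMap` TRANSPORTS** — the plain S-step of the Ward-residual table tower (`WardResidualSUnroll ∕ …SUnrolled`:
# `fun κ′u′ ↦ (Lc^{d+1}·wE (j+1)) • e3OfK Lc G_j S κ′u′`, `G_j = coDressKBmAt ρ Lc (KInvStep Lc j)`) IS `SrecBornSector.stepMap Lc ρ (Lc^{d+1}) j S` (`rfl`), so its `k`-fold composite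
# in the units of level `m+k` IS `transport (unitStepMap Lc ρ (Lc^{d+1})) m k (unitS_m S)` (leaf-01's `unitS_transport_stepMap'`, whose unit step carries the `j`-FREE weight
# `Lc^{d+1}·Lc^{2(d+1)}` and the kernel `coDressKBmAt ρ Lc (KStepUnit Lc j)`), and for an ff-valued local table ONE three-leg push through the dressed leg chain
# (`SrecBornSector.transport_unitStepMap_succ_eq_push₃`).  Hence the unrolled member of (REP) IN UNITS — the currency in which (LT) of the OWNER gan24-p1 g25's
# `gen25/QR-DESIGN-v0.md` §3 and leaf-01 g63's `LT-STATEMENT-v0.md` bound it (their (LT-0) ask: «is the bridge e3OfK-S-step ↔ push₃ in the tree?» — YES: this file + `SrecBornSector` §4–§5)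
# (road-P2 chair `b2b-balaban-gan24-p2`, gen 37).

NOT IN PRINT; OUR BOOKKEEPING ([folklore] rewriting over leaf-01's `SrecBornSector` §4 BY NAME).  HONEST FRAMING (cell contract, verbatim): «discharging `BetaPertH` makes Bałaban's UV
stability UNCONDITIONAL — a real constructive-QFT result; it is NOT the continuum limit and NOT the Clay problem.»  HONEST DEPENDENCY (verbatim): «continuum YM on T⁴ ⇐ BetaPertH ∧ nine
spine estimates (0/9 proved); BetaPertH ⇐ (D1) ∧ (D4) ∧ CAP+tail; G-an2-4 gates asym, D1 and NE2/3/4.»  No cited fact, no `def`, no `def … : Prop`, 0 sorry.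

* §1 **`transport_sStep_eq_transport_stepMap`** (`rfl`), `unitS_finset_sum'` (any index type), **`unitS_transport_sStep_comb`** (`m + k = t ⇒ unitS_t (transport 𝔖 m k S) =
  transport (unitStepMap Lc ρ (Lc^{d+1})) m k (unitS_m S)`), `unit_remainder_factor` (`(sf_j·sm_j)⁻¹·(stepScale j·Lc^{d+1}) = Lc^{d+1}`: leaf-06's unit remainder is
  `Lc^{d+1} • unitS_j (R_j y)` — the currency junction with (H) is a `j`-free scalar).
* §2 **`unitS_duhamel_blockSum_comb`**: from the unrolled identity of `WardResidualSUnrolled.exists_kernelLaws_unrolled` (taken as a HYPOTHESIS in table form at one `(n, Y)`),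
  `unitS_n (Φ n Y) = transport 𝔘 0 n (unitS_0 (Σ_{w∈box Lc^n} Φ 0 (Lc^n•Y+w))) + Σ_{m<n} transport 𝔘 (m+1) (n−1−m) (unitS_{m+1} (Σ_{w∈box Lc^{n−1−m}} σ m (Lc^{n−1−m}•Y+w)))`,
  `𝔘 = unitStepMap Lc ρ (Lc^{d+1})` — every transported object the UNIT-rescaled super-block partial sum of a letter at its own level.
Asserts NO bound, NO rate; discharges NOTHING of (Q-R) ∕ (LT) ∕ (C) ∕ «T2Shape» ∕ «T2Drift» ∕ (hW, hWall); NEVER «G-an2-4 closed» as (CONV-C); NOT D1, NOT BetaPertH, NOT continuum,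
NOT Clay.  Unit `b2b-balaban-gan24-p2` (gen 37), 2026-08-22; no existing file touched.
-/

noncomputable section

open Finset
open scoped BigOperators
open Literature.MathematicalPhysics.QuantumFieldTheory
open Literature.MathematicalPhysics.QuantumFieldTheory.Balaban1983to89
open Literature.MathematicalPhysics.QuantumFieldTheory.Balaban1983to89.Beta
open ExpKernelCalculus (MKer)
open AffineAveraging (Site box toSite)
open OneStepResolventKernel (Fib)
open OneStepKernelFamily (KInvStep)
open BalabanStepJetsSucc (wE)
open Summit.QuantumFields.BalabanUV.Beta.SpineRooted (e3OfK)
open Summit.QuantumFields.BalabanUV.Beta.AxialDressingRooted (coDressKBmAt)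
open Summit.QuantumFields.BalabanUV.Beta.HessKerDressedUnits (unitS unitS_apply)
open Summit.QuantumFields.BalabanUV.Beta.GAN24.CombesThomas (sfStep smStep sfStep_ne_zero smStep_ne_zero)
open Summit.QuantumFields.BalabanUV.Beta.GAN24.SrecBornSector (stepMap unitStepMap unitS_transport_stepMap')
open Summit.QuantumFields.BalabanUV.Beta.GAN24.AffineUnroll (transport)

namespace Summit.QuantumFields.BalabanUV.Beta.GAN24.WardResidualSUnits

variable {d Lc : ℕ} [NeZero Lc]

/-! ## §1 The (REP) transports are `stepMap` ∕ `unitStepMap` transports -/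

/-- [folklore] **THE PLAIN S-STEP OF (REP) IS leaf-01's `stepMap`** (`rfl`): the `k`-fold composites agree. -/
theorem transport_sStep_eq_transport_stepMap (ρ : Fin (d + 1) → ℤ) (m k : ℕ) (S : Fin (d + 1) → (Fin (d + 1) → ℤ) → MKer (d + 1) (Fib d)) :
    transport (fun j (S : Fin (d + 1) → (Fin (d + 1) → ℤ) → MKer (d + 1) (Fib d)) =>
        fun κ' u' => ((Lc : ℝ) ^ (d + 1) * wE d Lc (j + 1)) • e3OfK Lc (coDressKBmAt ρ Lc (KInvStep (d := d) Lc j)) S κ' u') m k S =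
      transport (stepMap Lc ρ ((Lc : ℝ) ^ (d + 1))) m k S := rfl

omit [NeZero Lc] in
/-- [folklore] `unitS` over a finite sum of families (any index type; leaf-01's `SrecBornSector.unitS_finset_sum` is the `ℕ`-indexed case). -/
theorem unitS_finset_sum' {ι : Type*} (sf sm : ℝ) (s : Finset ι) (F : ι → Fin (d + 1) → (Fin (d + 1) → ℤ) → MKer (d + 1) (Fib d)) :
    unitS sf sm (∑ i ∈ s, F i) = ∑ i ∈ s, unitS sf sm (F i) := by
  classical
  induction s using Finset.induction_on with
  | empty =>
    funext κ u x y a b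
    simp [unitS_apply]
  | @insert a s ha ih =>
    rw [Finset.sum_insert ha, Finset.sum_insert ha, ← ih]
    funext κ u x y a' b
    simp only [unitS_apply, Pi.add_apply]
    ring

/-- [folklore] **THE (REP) COMPOSITE IN UNITS**: for `m + k = t`, `unitS_t (transport 𝔖 m k S) = transport (unitStepMap Lc ρ (Lc^{d+1})) m k (unitS_m S)` — leaf-01's
`SrecBornSector.unitS_transport_stepMap'` after §1's `rfl` bridge. -/
theorem unitS_transport_sStep_comb (ρ : Fin (d + 1) → ℤ) {m k t : ℕ} (ht : m + k = t) (S : Fin (d + 1) → (Fin (d + 1) → ℤ) → MKer (d + 1) (Fib d)) :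
    unitS (sfStep Lc t) (smStep d Lc t) (transport (fun j (S : Fin (d + 1) → (Fin (d + 1) → ℤ) → MKer (d + 1) (Fib d)) =>
        fun κ' u' => ((Lc : ℝ) ^ (d + 1) * wE d Lc (j + 1)) • e3OfK Lc (coDressKBmAt ρ Lc (KInvStep (d := d) Lc j)) S κ' u') m k S) =
      transport (unitStepMap Lc ρ ((Lc : ℝ) ^ (d + 1))) m k (unitS (sfStep Lc m) (smStep d Lc m) S) := by
  rw [transport_sStep_eq_transport_stepMap]
  exact unitS_transport_stepMap' ρ _ ht S

/-- [folklore] **THE CURRENCY JUNCTION IS A `j`-FREE SCALAR**: leaf-06's unit remainder `(sf_j·sm_j)⁻¹ • unitS_j (cH′_j⁻¹ • R_j y)` (`T2SlavedDivergence.boxSum_divV_unitS₂_fst_of_tableLaw`,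
`cH′_j = (stepScale j·Lc^{d+1})⁻¹`) is `Lc^{d+1} • unitS_j (R_j y)`, because `(sf_j·sm_j)⁻¹·(stepScale j·Lc^{d+1}) = Lc^{d+1}` (`stepScale j = Lc^{j(d+2)} = sf_j·sm_j`) — so §2's
`unitS_n (Φ n Y)` IS the (H)-side currency up to the constant `Lc^{d+1}`. -/
theorem unit_remainder_factor (j : ℕ) :
    (sfStep Lc j * smStep d Lc j)⁻¹ * (BorderedHessian.stepScale d Lc j * (Lc : ℝ) ^ (d + 1)) = (Lc : ℝ) ^ (d + 1) := by
  have hL : (Lc : ℝ) ≠ 0 := Nat.cast_ne_zero.2 (NeZero.ne Lc)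
  have h : BorderedHessian.stepScale d Lc j = sfStep Lc j * smStep d Lc j := by
    simp only [BorderedHessian.stepScale, sfStep, smStep, ← pow_mul, ← pow_add]
    ring_nf
  rw [h, ← mul_assoc, inv_mul_cancel₀ (mul_ne_zero (sfStep_ne_zero j) (smStep_ne_zero (d := d) j)), one_mul]

/-! ## §2 The unrolled member of (REP) in units -/

/-- [folklore] **THE UNROLLED MEMBER IN UNITS (comb literal).**  If at one `(n, Y)` a label-table tower satisfies the unrolled identity of
`WardResidualSUnrolled.exists_kernelLaws_unrolled` (table form, hypothesis `hunroll`), then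
`unitS_n (Φ n Y) = transport 𝔘 0 n (unitS_0 (Σ_{w∈box Lc^n} Φ 0 (Lc^n•Y+w))) + Σ_{m<n} transport 𝔘 (m+1) (n−1−m) (unitS_{m+1} (Σ_{w∈box Lc^{n−1−m}} σ m (Lc^{n−1−m}•Y+w)))`,
`𝔘 = unitStepMap Lc ρ (Lc^{d+1})` (leaf-01's unit level map: `(Lc^{d+1}·Lc^{2(d+1)}) • e3K (coDressKBmAt ρ Lc (KStepUnit Lc j)) Lc`, the `j`-free weight) — every transported object
is the UNIT-rescaled super-block partial sum of a letter at its own level; for ff-valued local tables each transport is ONE `push₃` through the dressed leg chain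
(`SrecBornSector.transport_unitStepMap_succ_eq_push₃`) — the objects (LT) bounds. -/
theorem unitS_duhamel_blockSum_comb (ρ : Fin (d + 1) → ℤ)
    {Φ σ : ℕ → (Fin (d + 1) → ℤ) → Fin (d + 1) → (Fin (d + 1) → ℤ) → MKer (d + 1) (Fib d)} (n : ℕ) (Y : Fin (d + 1) → ℤ)
    (hunroll : Φ n Y =
      transport (fun j (S : Fin (d + 1) → (Fin (d + 1) → ℤ) → MKer (d + 1) (Fib d)) =>
          fun κ' u' => ((Lc : ℝ) ^ (d + 1) * wE d Lc (j + 1)) • e3OfK Lc (coDressKBmAt ρ Lc (KInvStep (d := d) Lc j)) S κ' u') 0 n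
          (∑ w ∈ box (d + 1) (Lc ^ n), Φ 0 (((Lc ^ n : ℕ) : ℤ) • Y + toSite w))
      + ∑ m ∈ Finset.range n,
          transport (fun j (S : Fin (d + 1) → (Fin (d + 1) → ℤ) → MKer (d + 1) (Fib d)) =>
              fun κ' u' => ((Lc : ℝ) ^ (d + 1) * wE d Lc (j + 1)) • e3OfK Lc (coDressKBmAt ρ Lc (KInvStep (d := d) Lc j)) S κ' u') (m + 1) (n - 1 - m)
            (∑ w ∈ box (d + 1) (Lc ^ (n - 1 - m)), σ m (((Lc ^ (n - 1 - m) : ℕ) : ℤ) • Y + toSite w))) :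
    unitS (sfStep Lc n) (smStep d Lc n) (Φ n Y) =
      transport (unitStepMap Lc ρ ((Lc : ℝ) ^ (d + 1))) 0 n
          (unitS (sfStep Lc 0) (smStep d Lc 0) (∑ w ∈ box (d + 1) (Lc ^ n), Φ 0 (((Lc ^ n : ℕ) : ℤ) • Y + toSite w)))
      + ∑ m ∈ Finset.range n, transport (unitStepMap Lc ρ ((Lc : ℝ) ^ (d + 1))) (m + 1) (n - 1 - m)
          (unitS (sfStep Lc (m + 1)) (smStep d Lc (m + 1)) (∑ w ∈ box (d + 1) (Lc ^ (n - 1 - m)), σ m (((Lc ^ (n - 1 - m) : ℕ) : ℤ) • Y + toSite w))) := by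
  have hadd : ∀ (A B : Fin (d + 1) → (Fin (d + 1) → ℤ) → MKer (d + 1) (Fib d)) (sf sm : ℝ), unitS sf sm (A + B) = unitS sf sm A + unitS sf sm B := by
    intro A B sf sm
    funext κ u x y a b
    simp only [unitS_apply, Pi.add_apply]
    ring
  rw [hunroll, hadd, unitS_finset_sum', unitS_transport_sStep_comb ρ (Nat.zero_add n)]
  congr 1
  refine Finset.sum_congr rfl fun m hm => ?_
  have hmn : m + 1 + (n - 1 - m) = n := by
    have := Finset.mem_range.mp hm
    omega
  rw [unitS_transport_sStep_comb ρ hmn]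

end Summit.QuantumFields.BalabanUV.Beta.GAN24.WardResidualSUnits

end
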